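import Mathlib
import HarnessLib
import Summits.QuantumAdvantage.QuantumAdvantage.Theses.SosSandwich
import Literature.Barriers.QuantumAdvantage.RandomOracleMethodThm23
import Literature.Computability.QuantumComplexity.AaronsonAmbainisThm23Queries
import Literature.Computability.QuantumComplexity.RandomOracleIndependence
import Literature.Computability.QuantumComplexity.PseudoBounded
import Literature.Computability.Cryptography.QuantumCircuitProofs
import Summits.QuantumAdvantage.QuantumAdvantage.Theorems.SosSandwichTransferPBDefs
import Summits.QuantumAdvantage.QuantumAdvantage.Theorems.SosSandwichTransferPBStubOracleAcceptPseudoBounded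

/-!
# Line `birth` — BC3 skeleton for the crux `TransferPB` (stmt-QuantumAdvantage-15238)

Route `SosSandwich` (route-QuantumAdvantage-SosSandwich; deciding theorem
`closes (hK : PseudoBoundedAA) (hT : TransferPB) (hX : RandomOracleHeurSeparation) (hPL : PromiseLanguageLift) :
QuantumAdvantage`), crux (rank 3)

  `TransferPB := PseudoBoundedAA → PromiseBQP ⊆ PromiseBPP' →
      ∀ᵐ A ∂randomOracle, BQPRel A ⊆ Complexity.AvgPRel (Oracle.ofLanguage A)`,

i.e. Aaronson–Ambainis Thm 7(iii)/23 (arXiv:0911.0996) with `P = P^#P` replaced by `PromiseBQP ⊆ PromiseBPP'`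
and the influence hypothesis (Conjecture 6 = `AAConjecture`) WEAKENED to the route's pseudo-bounded form
`PseudoBoundedAA` (PB-AA: influence bound only for polynomials of the SOS sandwich class `K_T`).  It is the
sibling of the shared crux `PromiseTransfer` (stmt-QuantumAdvantage-10749 / -11702; `AAConjecture` antecedent),
whose registered line `Cruxes/PromiseTransfer/Lines/promise_oracle_split.lean` cuts along the seam
"simulation WITH a promise oracle / elimination OF the promise oracle".  This skeleton takes the SAME seam and adds
the one seam that is `TransferPB`'s own: WHERE the weakening `AAConjecture ↦ PB-AA` is absorbed.

## The line (3 registered stubs — stub 1 now PROVED in the tree — + the PROVED composition)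

* `stub_oracleAcceptPseudoBounded` (M, TRUE — Beals–Buhrman–Cleve–Mosca–de Wolf Lemma 4.1 for ORACLE circuits +
  unitarity; the oracle-circuit twin of the route's support `QueryAcceptPseudoBounded`, stmt-15242): for every
  Clifford+T oracle circuit family `F` and input `x`, the tree's acceptance polynomial `acceptPoly F x` (in the
  `numOracleBits F x` relevant oracle bits; `evalBool (acceptPoly F x) (oracleBits F x A) = F.acceptProbOn A x`)
  is PSEUDO-BOUNDED OF ORDER `(F.circ |x|).oracleQueries` (tree `PseudoBounded`, fact-free module): on the cube,
  `p = Σ_{y accepted} (Re amp_y)² + (Im amp_y)²` and `1 − p = Σ_{y rejected} (…)²` with amplitude polynomials of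
  degree `≤ #oracle gates` (tree `ohasDegreeLE_toMatrix_mulVec`, renamed along `bitEquiv`; `1 − p` by the unit
  norm of the final state).  This is the statement that puts every polynomial the Aaronson–Ambainis greedy ever
  restricts inside `K_T` (restriction-closure is the tree's `PseudoBounded.restrict`).
* `stub_pbOracleSimulation` (XL, LOAD-BEARING): AARONSON–AMBAINIS THM 23 RELATIVE TO A PROMISE-BQP ORACLE UNDER
  PB-AA.  Granted stub 1's statement and `PseudoBoundedAA`, for every uniform oracle family `F` and polynomial
  `r` there are `Q ∈ PromiseBQP` and ONE deterministic polynomial-time transcript machine `C` (budget `q`) such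
  that for every input `x` (`n ≥ 1`) and EVERY answer function `g` correct on `Q`'s promise (arbitrary off it,
  fixed independently of `A`), `μ{A | C^{A ⊕ g}(x) is wrong about the BQP-promise bit of F^A(x)} ≤ 1/(r(n)+1)`.
  Verbatim the conclusion of the sibling piece `PromiseOracleSimulation`; the antecedent `AAConjecture` is
  replaced by `stub 1 ∧ PB-AA` — the proof plan (robust/gapped Thm 21 greedy on the restricted acceptance
  polynomial `p_ρ`, potential `E_b SumInf(p|i←b) = SumInf(p) − Inf_i(p)`, Markov cut-off, Chebyshev at halting
  leaves = tree `ClassicalSimulation.simTree_depth_error_le`; moments over a `4T`-wise independent hashed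
  completion = tree `sum_acceptProb_eq_of_isKWiseIndepFamily`; estimations as instances of the
  `PromiseBQP`-complete QSIM, tree `qSimProblem` / `AaronsonAmbainis2018_lemma24_mem_holds`; BBBV prefix descent
  for the influential bits) applies the influence hypothesis ONLY to restrictions `p_ρ` of `acceptPoly F x`
  (in `simTree_depth_error_le` the hypothesis `H` is used through `hAA'` on `restrictPoly`-iterates of `p` only),
  which are pseudo-bounded of order `T = #oracle gates ≤ size` by stub 1 + `PseudoBounded.restrict`, so PB-AA at
  order `T` (bound `C (ε/T)^c`, `T ≤ poly(n)`) is all that is consumed.  Why it might fail: as the crux — gapped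
  answers in the greedy, and the hashed SURROGATE used for the moment estimations must never be fed to PB-AA
  (it need not lie in `K_T`); only true restrictions are.
* `stub_promiseOracleElimination` (L, provable now; VERBATIM piece 2 of the sibling split, so ONE proof serves
  both cruxes): a `PromiseBPP'` oracle is redundant relative to a random oracle — Bennett–Gill coins read off far
  oracle positions (a finite window `V` of strings longer than `ℓ(n)`), majority amplification, union bound over
  the `≤ 2^(q(n)+1)` short promise instances; `C'^A` reproduces every halting output of `C^{A ⊕ ĝ(A)}` and
  `ĝ(A)` is inconsistent with `Q` only on measure `≤ 1/(r(n)+1)`.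
* Composition (sorry-free, ported from the sibling's PROVED glue `promiseTransfer_of_subs`):
  `PromiseBQP ⊆ PromiseBPP'` moves `Q` into `PromiseBPP'`; the bad event of `C'` is covered by the inconsistency
  event plus "ĝ(A) consistent and `C^{A ⊕ ĝ(A)}` wrong"; the latter is bounded by the Bennett–Gill window lemma
  `measure_inter_le_of_window` with the SHORT window (strings of length `≤ ℓ(n)`, which determine `F^A(x)` and
  the `A`-queries of `C`; `ĝ` reads only `V`, all longer); union bound `1/(2n³+1) + 1/(4n³+1) < 1/n³`; the
  tree's Markov/Borel–Cantelli half `ae_BQPRel_subset_AvgPRel_of_apxMachines`; the conclusion over the fact-free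
  `randomOracle` / `Complexity.AvgPRel` is the tree's `randomOracleMeasure` / `Barriers….AvgPRel` by `rfl`
  (reducible synonyms).  `TransferPB_of : Sig.stub_oracleAcceptPseudoBounded → Sig.stub_pbOracleSimulation →
  Sig.stub_promiseOracleElimination → TransferPB` concludes the route decl BY NAME; `TransferPB_proof : TransferPB`
  is the skeleton in its final shape (depends on `sorryAx` through the three stubs only).

## Disproof / negatives / dead lines used

`Cruxes/TransferPB/` had no workfiles before this one (`ledger crux ls stmt-QuantumAdvantage-15238`, 2026-08-17:
no `Disproof.lean`, no ideas, no dead lines).  None of the 6 entries of `ledger negatives --problem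
QuantumAdvantage` (regulator/BPP, Shor marginals, cubic stability, spinor Gauss rank, Kummer sector, two-qubit
frames) concerns random-oracle transfer, pseudo-boundedness or promise-oracle elimination.  The item's grounder
notes (2026-08-16: "= 10749 with antecedent weakened to PB-AA, sound by inspection: AA14 Thm 21 p. 13 applies
Conj 6 only to restrictions of the acceptance polynomial") are honoured at `stub_pbOracleSimulation`, whose
antecedent is exactly stub 1 ∧ PB-AA; the refuter's why-might-fail ("prBPP' coins vs AvgPRel's deterministic
machine" = stub 3; "robustness of the greedy to gapped Inf tests" + "no surrogate outside K_T" = stub 2) is the cut.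

## BC3 audit (this seat; raw outputs in the seat's NOTES.md `birth-certificate:`)

`lean check --json` rc 0 with `sorry` exactly in `stub_oracleAcceptPseudoBounded`, `stub_pbOracleSimulation`,
`stub_promiseOracleElimination` (sorry count 3 = stub count, zero elsewhere); probes `stub → TransferPB` and
`stub → QuantumAdvantage` by `first | exact? | simpa [stub] | (unfold stub; simpa) | aesop` FAIL for all three
stubs (6/6), files `bc/TransferPB_probe_<stub>_<target>.lean` of the seat folder.
-/

set_option linter.dupNamespace false
set_option linter.unusedVariables false

noncomputable section

namespace Summit.QuantumAdvantage.QuantumAdvantage.Cruxes.TransferPB.Birth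

open MeasureTheory Literature.Computability.Complexity Literature.Computability.Cryptography
  Literature.Computability.QuantumComplexity Literature.Barriers.QuantumAdvantage
open Summit.QuantumAdvantage.QuantumAdvantage.Theses.SosSandwich
open scoped ENNReal

/-! ## The three stub statements, named (`Sig.stub_<name>`)

Re-pointed 2026-08-31 (lead hand leafhand-qadv-sossandwich-1 g0): the statements `Sig.stub_oracleAcceptPseudoBounded`,
`OracleSimulation`, `Sig.stub_pbOracleSimulation`, `Sig.stub_promiseOracleElimination` now live VERBATIM (same namespace,
same names) in the importable tree module `Theorems/SosSandwichTransferPBDefs.lean` (p796086), and STUB 1 is PROVED in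
`Theorems/SosSandwichTransferPBStubOracleAcceptPseudoBounded.lean` (p796680, `stub_oracleAcceptPseudoBounded`, closed by
name on stmt-QuantumAdvantage-15238); their local copies are deleted here (zero renaming), so `TransferPB_proof` below now
depends on `sorryAx` only through the two remaining stubs. -/

/-! ## The three registered stubs -/

-- STUB 1 `stub_oracleAcceptPseudoBounded : Sig.stub_oracleAcceptPseudoBounded` — PROVED, imported from
-- `Theorems/SosSandwichTransferPBStubOracleAcceptPseudoBounded.lean` (p796680).

/-- **STUB 2 (XL, load-bearing): Aaronson–Ambainis Thm 23 relative to a promise-BQP oracle under PB-AA.**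
The sibling's plan for `PromiseOracleSimulation` (robust Thm 21 greedy + `4T`-wise independent hashing + QSIM
estimations + BBBV descent, one uniform machine; its birth skeleton `Cruxes/PromiseTransfer/Lines/
birth_PromiseOracleSimulation.lean` isolates the explicit hash family), with the influence hypothesis invoked
ONLY on restrictions of `acceptPoly F x` — members of `K_T` by stub 1 and `PseudoBounded.restrict` — so that
`PseudoBoundedAA` at order `T = (F.circ n).oracleQueries ≤ size(n)` replaces `AAConjecture` at degree `2T`.
Leans on: `ClassicalSimulation.simTree_depth_error_le` (to be re-run with the class hypothesis),
`sum_acceptProb_eq_of_isKWiseIndepFamily`, `qSimProblem` / `AaronsonAmbainis2018_lemma24_mem_holds`,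
`AaronsonAmbainisThm23Machine` (the `#P` machine as template), `PseudoBounded.restrict`, `PseudoBounded.bounded`.
Sources: arXiv:0911.0996 (Thm 21, Thm 23), doi:10.1007/978-3-642-32009-5_44 (Zhandry, k-wise independence),
arXiv:quant-ph/9701001 (BBBV), arXiv:1411.7280. -/
theorem stub_pbOracleSimulation : Sig.stub_pbOracleSimulation := by
  sorry

/-- **STUB 3 (L, provable now): promise-BPP' oracle elimination relative to a random oracle** — verbatim the
sibling's registered `stub_promiseOracleElimination` (Bennett–Gill coins-from-the-oracle + amplification + union
bound over the short promise instances). Leans on: `AlmostPProofs` (lazy sampling), `RandomOracleCylinders`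
(`restrictBool`, `IsDetermined.measure_eq`), `PromiseBPP'`, BPP amplification. Sources: BennettGill1981,
Goldreich2006, AroraBarak2009. -/
theorem stub_promiseOracleElimination : Sig.stub_promiseOracleElimination := by
  sorry

/-! ## Vocabulary of the glue (definitional abbreviations of the inline terms above) -/

/-- The combined oracle `A ⊕ g`: `false :: v ↦ [v ∈ A]`, `true :: v ↦ g v`, `[] ↦ false`. [folklore] -/
def combine (A : Set (List Bool)) (g : List Bool → Bool) : Oracle :=
  Oracle.ofLanguage {w : List Bool | ∃ v : List Bool, (w = false :: v ∧ v ∈ A) ∨ (w = true :: v ∧ g v = true)}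

/-- `g` answers the promise problem `Q` correctly on its promise. [folklore] -/
def Consistent (Q : PromiseProblem) (g : List Bool → Bool) : Prop :=
  (∀ v ∈ Q.yes, g v = true) ∧ (∀ v ∈ Q.no, g v = false)

/-- The bad event of stub 2 for a FIXED answer function `g`: `C^{A ⊕ g}` is wrong about the `BQP`-promise bit
of `F^A` at `x`. [folklore] -/
def badWith (F : QCircuitFamily cliffordT) (C : OracleAlg Bool) (q : Polynomial ℕ) (x : List Bool)
    (g : List Bool → Bool) : Set (Set (List Bool)) :=
  {A | (2 / 3 ≤ F.acceptProbOn A x ∧ C.run (combine A g) (q.eval x.length) x ≠ some true) ∨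
       (F.acceptProbOn A x ≤ 1 / 3 ∧ C.run (combine A g) (q.eval x.length) x ≠ some false)}

/-! ## Locality lemmas (ported verbatim from the sibling's proved glue) -/

/-- Runs are determined by the answers to the queries asked (induction on the fuel). [folklore] -/
theorem runAux_congr {β : Type} (M : OracleAlg β) {O O' : Oracle} (x : List Bool) :
    ∀ (k : ℕ) (ans : List (List Bool)), (∀ y ∈ M.queriesAux O x k ans, O' y = O y) →
      M.runAux O' x k ans = M.runAux O x k ans ∧ M.queriesAux O' x k ans = M.queriesAux O x k ans
  | 0, _, _ => ⟨rfl, rfl⟩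
  | k + 1, ans, h => by
    unfold OracleAlg.runAux OracleAlg.queriesAux
    unfold OracleAlg.queriesAux at h
    cases hs : M.step x ans with
    | inr b => simp
    | inl qy =>
      simp only [hs, List.mem_cons, forall_eq_or_imp] at h
      obtain ⟨hq, hrest⟩ := h
      simp only [hq]
      obtain ⟨h1, h2⟩ := runAux_congr M x k (ans ++ [O qy]) hrest
      exact ⟨h1, by rw [h2]⟩

/-- Runs against oracles agreeing on the queries coincide. [folklore] -/
theorem run_congr {β : Type} (M : OracleAlg β) {O O' : Oracle} {k : ℕ} {x : List Bool}
    (h : ∀ y ∈ M.queries O k x, O' y = O y) : M.run O' k x = M.run O k x :=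
  (runAux_congr M x k [] h).1

/-- Two oracles of languages agree at a string on which membership agrees. [folklore] -/
theorem ofLanguage_apply_congr {S S' : Set (List Bool)} {y : List Bool} (h : y ∈ S ↔ y ∈ S') :
    Oracle.ofLanguage S y = Oracle.ofLanguage S' y := by
  simp only [Oracle.ofLanguage_apply]
  by_cases hy : y ∈ S
  · rw [(Set.mem_iff_boolIndicator S y).1 hy, (Set.mem_iff_boolIndicator S' y).1 (h.1 hy)]
  · rw [(Set.notMem_iff_boolIndicator S y).1 hy, (Set.notMem_iff_boolIndicator S' y).1 (fun h' => hy (h.2 h'))]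

/-- The combined oracles of two languages agreeing on strings of length `≤ L` agree on queries of length
`≤ L + 1`. [folklore] -/
theorem combine_congr {A A' : Set (List Bool)} (g : List Bool → Bool) {L : ℕ}
    (h : ∀ v : List Bool, v.length ≤ L → (v ∈ A ↔ v ∈ A')) {y : List Bool} (hy : y.length ≤ L + 1) :
    combine A' g y = combine A g y := by
  refine ofLanguage_apply_congr ?_
  simp only [Set.mem_setOf_eq]
  have key : ∀ v, y = false :: v → (v ∈ A ↔ v ∈ A') := fun v hv => h v (by subst hv; simpa using hy)
  constructor
  · rintro ⟨v, ⟨hv, hvA⟩ | ⟨hv, hvg⟩⟩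
    · exact ⟨v, Or.inl ⟨hv, (key v hv).2 hvA⟩⟩
    · exact ⟨v, Or.inr ⟨hv, hvg⟩⟩
  · rintro ⟨v, ⟨hv, hvA⟩ | ⟨hv, hvg⟩⟩
    · exact ⟨v, Or.inl ⟨hv, (key v hv).1 hvA⟩⟩
    · exact ⟨v, Or.inr ⟨hv, hvg⟩⟩

/-- Equal restrictions to `shortStrings (L + 1)` = agreement on all strings of length `≤ L`. [folklore] -/
theorem agree_of_restrictBool_eq {L : ℕ} {A A' : Set (List Bool)}
    (h : restrictBool (shortStrings (L + 1)) A = restrictBool (shortStrings (L + 1)) A') :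
    ∀ v : List Bool, v.length ≤ L → (v ∈ A ↔ v ∈ A') := by
  intro v hv
  have hmem : v ∈ shortStrings (L + 1) := mem_shortStrings.2 (by omega)
  have := congrFun h ⟨v, hmem⟩
  rw [restrictBool_apply, restrictBool_apply] at this
  exact (@decide_eq_decide _ _ (Classical.propDecidable _) (Classical.propDecidable _)).1 this

/-- **Locality of the fixed-`g` bad event**: it is determined by the oracle bits on the strings of length
`≤ L` as soon as `L` bounds the width of `F` at `x` and the query length of `C` at `x`. [folklore] -/
theorem isDetermined_badWith (F : QCircuitFamily cliffordT) (C : OracleAlg Bool) (q : Polynomial ℕ)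
    (x : List Bool) (g : List Bool → Bool) {L : ℕ}
    (hF : x.length + F.ancillas x.length ≤ L + 1)
    (hC : ∀ (O : Oracle), ∀ y ∈ C.queries O (q.eval x.length) x, y.length ≤ q.eval x.length)
    (hq : q.eval x.length ≤ L + 1) :
    IsDetermined (shortStrings (L + 1)) (badWith F C q x g) := by
  intro A A' h
  have hag := agree_of_restrictBool_eq h
  have hp : F.acceptProbOn A x = F.acceptProbOn A' x :=
    QCircuitFamily.acceptProbOn_congr F x fun u hu => hag u (by omega)
  have hr : C.run (combine A g) (q.eval x.length) x = C.run (combine A' g) (q.eval x.length) x := by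
    refine (run_congr C fun y hy => ?_).symm
    exact combine_congr g hag ((hC _ y hy).trans hq)
  simp only [badWith, Set.mem_setOf_eq, hp, hr]

/-! ## The glue -/

/-- **The glue of the line** (the sibling's `promiseTransfer_of_subs`, conclusion respelled over the fact-free
`randomOracle` / `Complexity.AvgPRel`, which the tree's `randomOracleMeasure` / `Barriers….AvgPRel` unfold to
reducibly): average-case simulation with a promise-BQP oracle + elimination of a promise-BPP' oracle +
`PromiseBQP ⊆ PromiseBPP'` give the almost-sure collapse `BQP^A ⊆ AvgP^A`. [folklore] -/
theorem ae_BQPRel_subset_AvgPRel_of_simulation (h₁ : OracleSimulation)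
    (h₂ : Sig.stub_promiseOracleElimination)
    (hPr : Literature.Computability.Cryptography.PromiseBQP ⊆ Literature.Computability.Complexity.PromiseBPP') :
    ∀ᵐ A ∂randomOracle,
      BQPRel (A : Language Bool) ⊆
        Literature.Computability.Complexity.AvgPRel (Oracle.ofLanguage (A : Language Bool)) := by
  have key : ∀ᵐ A ∂randomOracleMeasure,
      BQPRel (A : Language Bool) ⊆
        Literature.Barriers.QuantumAdvantage.AvgPRel (Oracle.ofLanguage (A : Language Bool)) := by
    refine ae_BQPRel_subset_AvgPRel_of_apxMachines fun F hU => ?_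
    -- polynomial size of the uniform family (width bound)
    obtain ⟨pF, hpF⟩ := QCircuitFamily.IsUniform.isPolySize' hU
    -- stub 2 with error polynomial `4 X³`
    obtain ⟨Q, hQ, C, q, hCpoly, hCq, hC⟩ := h₁ F hU (4 * Polynomial.X ^ 3)
    -- the hypothesis of `TransferPB` moves `Q` into `PromiseBPP'`
    have hQ' : Q ∈ PromiseBPP' := hPr hQ
    -- stub 3 with the short horizon `ℓ = X + pF + q` and error polynomial `2 X³`
    obtain ⟨C', q', hC'poly, hC'q, hC'⟩ :=
      h₂ Q hQ' C q hCpoly hCq (Polynomial.X + pF + q) (2 * Polynomial.X ^ 3)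
    refine ⟨C', q', hC'poly, hC'q, fun x hx => ?_⟩
    obtain ⟨V, ĝ, hVfar, hĝloc, hrun, hincons⟩ := hC' x hx
    -- notation: the short horizon `L = ℓ(n) = n + pF(n) + q(n)` and the short window `S`
    set L : ℕ := (Polynomial.X + pF + q).eval x.length with hL
    have hLeval : L = x.length + pF.eval x.length + q.eval x.length := by
      simp [hL, Polynomial.eval_add, Polynomial.eval_X]
    set S : Finset (List Bool) := shortStrings (L + 1) with hS
    have hwidth : x.length + F.ancillas x.length ≤ L + 1 := by
      have := (hpF x.length).2; rw [hLeval]; omega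
    have hqL : q.eval x.length ≤ L + 1 := by rw [hLeval]; omega
    have hdet : ∀ g, IsDetermined S (badWith F C q x g) := fun g =>
      isDetermined_badWith F C q x g hwidth (fun O => hCq O x) hqL
    -- `V` misses the short window
    have hVS : ∀ v ∈ V, v ∉ S := fun v hv hvS => by
      have h1 := hVfar v hv; have h2 := mem_shortStrings.1 hvS; omega
    -- the two covering events
    set B₁ : Set (Set (List Bool)) := {A | ¬ Consistent Q (ĝ A)} with hB₁
    set B₂ : Set (Set (List Bool)) := {A | Consistent Q (ĝ A) ∧ A ∈ badWith F C q x (ĝ A)} with hB₂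
    have hsub : badEvent F C' q' x ⊆ B₁ ∪ B₂ := by
      intro A hA
      by_cases hc : Consistent Q (ĝ A)
      · refine Or.inr ⟨hc, ?_⟩
        rcases hA with ⟨hp, hne⟩ | ⟨hp, hne⟩
        · exact Or.inl ⟨hp, fun heq => hne (hrun A true heq)⟩
        · exact Or.inr ⟨hp, fun heq => hne (hrun A false heq)⟩
      · exact Or.inl hc
    -- bound on `B₁`: stub 3
    have hB₁le : randomOracleMeasure B₁ ≤
        ENNReal.ofReal (1 / ((((2 * Polynomial.X ^ 3 : Polynomial ℕ).eval x.length : ℕ) : ℝ) + 1)) :=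
      hincons
    -- `ĝ` ignores the short window
    have hĝpatch : ∀ (A₀ : Set (List Bool)) (w : S → Bool), ĝ (patchFin A₀ S w) = ĝ A₀ := by
      intro A₀ w
      rw [hĝloc (patchFin A₀ S w), hĝloc A₀]
      congr 1
      ext s
      simp only [Set.mem_inter_iff, Finset.mem_coe]
      constructor
      · rintro ⟨hs, hsV⟩; exact ⟨(mem_patchFin_of_not_mem w (hVS s hsV)).1 hs, hsV⟩
      · rintro ⟨hs, hsV⟩; exact ⟨(mem_patchFin_of_not_mem w (hVS s hsV)).2 hs, hsV⟩
    -- `B₂` is determined by the finite set `S ∪ V`, hence measurable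
    have hB₂det : IsDetermined (S ∪ V) B₂ := by
      intro A A' h
      have hSA : restrictBool S A = restrictBool S A' := funext fun u => by
        have := congrFun h ⟨u.1, Finset.mem_union_left V u.2⟩
        simpa only [restrictBool_apply] using this
      have hVA : A ∩ ↑V = A' ∩ ↑V := by
        ext s
        simp only [Set.mem_inter_iff, Finset.mem_coe]
        constructor
        · rintro ⟨hs, hsV⟩
          have := congrFun h ⟨s, Finset.mem_union_right S hsV⟩
          rw [restrictBool_apply, restrictBool_apply] at this
          exact ⟨((@decide_eq_decide _ _ (Classical.propDecidable _) (Classical.propDecidable _)).1 this).1 hs, hsV⟩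
        · rintro ⟨hs, hsV⟩
          have := congrFun h ⟨s, Finset.mem_union_right S hsV⟩
          rw [restrictBool_apply, restrictBool_apply] at this
          exact ⟨((@decide_eq_decide _ _ (Classical.propDecidable _) (Classical.propDecidable _)).1 this).2 hs, hsV⟩
      have hĝA : ĝ A = ĝ A' := by rw [hĝloc A, hĝloc A', hVA]
      simp only [hB₂, Set.mem_setOf_eq, hĝA, hdet (ĝ A') hSA]
    have hB₂meas : MeasurableSet B₂ := hB₂det.measurableSet
    -- bound on `B₂`: the window lemma with the short window `S`, trivial background event
    set θ : ℝ≥0∞ :=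
      ENNReal.ofReal (1 / ((((4 * Polynomial.X ^ 3 : Polynomial ℕ).eval x.length : ℕ) : ℝ) + 1)) with hθ
    have hB₂le : randomOracleMeasure B₂ ≤ θ := by
      have hwin := measure_inter_le_of_window S (E := B₂) (F := Set.univ) (θ := θ) hB₂meas
        MeasurableSet.univ (fun A => by simp) (fun A₀ => ?_)
      · simpa using hwin
      -- per background: the stub-2 bound for the FIXED consistent `g = ĝ A₀` (or the empty set)
      rw [← randomOracleMeasure_patchFin_mem B₂ S A₀]
      by_cases hc : Consistent Q (ĝ A₀)
      · have hset : {A : Set (List Bool) | patchFin A₀ S (restrictBool S A) ∈ B₂} = badWith F C q x (ĝ A₀) := by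
          ext A
          simp only [hB₂, Set.mem_setOf_eq, hĝpatch]
          rw [hdet (ĝ A₀) (restrictBool_patchFin A₀ S (restrictBool S A))]
          exact ⟨fun h => h.2, fun h => ⟨hc, h⟩⟩
        rw [hset]
        exact hC x hx (ĝ A₀) hc.1 hc.2
      · have hset : {A : Set (List Bool) | patchFin A₀ S (restrictBool S A) ∈ B₂} = ∅ := by
          ext A
          simp only [hB₂, Set.mem_setOf_eq, hĝpatch, Set.mem_empty_iff_false, iff_false, not_and]
          exact fun h => absurd h hc
        rw [hset, measure_empty]
        exact bot_le
    -- arithmetic: `1/(2n³+1) + 1/(4n³+1) < 1/n³`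
    set n : ℕ := x.length with hn
    have h2 : ((2 * Polynomial.X ^ 3 : Polynomial ℕ).eval n : ℕ) = 2 * n ^ 3 := by
      simp [Polynomial.eval_mul, Polynomial.eval_pow, Polynomial.eval_X]
    have h4 : ((4 * Polynomial.X ^ 3 : Polynomial ℕ).eval n : ℕ) = 4 * n ^ 3 := by
      simp [Polynomial.eval_mul, Polynomial.eval_pow, Polynomial.eval_X]
    have hn1 : (1 : ℝ) ≤ n := by exact_mod_cast hx
    have hN : (1 : ℝ) ≤ (n : ℝ) ^ 3 := one_le_pow₀ hn1
    have hreal : 1 / ((((2 * n ^ 3 : ℕ)) : ℝ) + 1) + 1 / ((((4 * n ^ 3 : ℕ)) : ℝ) + 1) < 1 / (n : ℝ) ^ 3 := by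
      push_cast
      rw [div_add_div _ _ (by positivity) (by positivity), div_lt_div_iff₀ (by positivity) (by positivity)]
      nlinarith [hN]
    calc randomOracleMeasure (badEvent F C' q' x)
        ≤ randomOracleMeasure (B₁ ∪ B₂) := measure_mono hsub
      _ ≤ randomOracleMeasure B₁ + randomOracleMeasure B₂ := measure_union_le _ _
      _ ≤ ENNReal.ofReal (1 / ((((2 * n ^ 3 : ℕ)) : ℝ) + 1)) + ENNReal.ofReal (1 / ((((4 * n ^ 3 : ℕ)) : ℝ) + 1)) := by
          refine add_le_add ?_ ?_
          · rw [← h2]; exact hB₁le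
          · rw [← h4]; exact hB₂le
      _ = ENNReal.ofReal (1 / ((((2 * n ^ 3 : ℕ)) : ℝ) + 1) + 1 / ((((4 * n ^ 3 : ℕ)) : ℝ) + 1)) :=
          (ENNReal.ofReal_add (by positivity) (by positivity)).symm
      _ < ENNReal.ofReal (1 / (n : ℝ) ^ 3) := by
          rw [ENNReal.ofReal_lt_ofReal_iff (by positivity)]
          exact hreal
  exact key

/-! ## Composition -/

/-- **The line closes the crux BY NAME modulo the two remaining registered stubs.** Stub 2, fed the PROVED stub 1 and the crux's
antecedent `PseudoBoundedAA`, gives the promise-oracle simulation; the glue combines it with stub 3 and the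
crux's second antecedent `PromiseBQP ⊆ PromiseBPP'`. [bookkeeping] -/
theorem TransferPB_of :
    Sig.stub_pbOracleSimulation → Sig.stub_promiseOracleElimination →
      Summit.QuantumAdvantage.QuantumAdvantage.Theses.SosSandwich.TransferPB :=
  -- stub 1 is PROVED in the tree (`stub_oracleAcceptPseudoBounded`, imported): it is fed to stub 2 here
  fun h₂ h₃ hK hPr => ae_BQPRel_subset_AvgPRel_of_simulation (h₂ stub_oracleAcceptPseudoBounded hK) h₃ hPr

/-- The skeleton in its final shape: the crux BY NAME from the two remaining registered stubs (stub 1 proved, imported); it becomes the crux proof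
when the last `stub_*` is discharged (until then it depends on `sorryAx` through the stubs only — no `sorry` of
its own). -/
theorem TransferPB_proof : Summit.QuantumAdvantage.QuantumAdvantage.Theses.SosSandwich.TransferPB :=
  TransferPB_of stub_pbOracleSimulation stub_promiseOracleElimination

end Summit.QuantumAdvantage.QuantumAdvantage.Cruxes.TransferPB.Birth

end
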